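import Summits.AtomisticToContinuum.FouriersLaw.Theorems.EmbeddedDrudeMourreFGRGapGenericB

/-!
# FGRGap, line `fold-jet-rigidity` — stub GB `stub_fibreGenericity` (fibre genericity)

Registered stub `stub_fibreGenericity` of the lead's skeleton for crux `EmbeddedDrudeMourre.FGRGap`
(item stmt-AtomisticToContinuum-12595), proved with exactly the registered signature; continues
`…GenericA/B`. Given a partner map `h` of the resonant set with the GA properties (conclusion of
`stub_branchStructure`): (C1) every fibre `k₁ = const` carries, for each `r ≥ 0`, a resonance
`(k₁, h k₁ k₃; k₃, k₁ + h - k₃)` in general position (six pairwise distinct group velocities) with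
`vertex 1 r ≠ 0`; (C2) the equal-velocity set `{v p.2 = v p.1}` is Lebesgue-null (part A); (C3) for
`a > 0`, `b ≥ 0` the vertex zero set is Lebesgue-null.

Proof (this file): along a fibre and off the countable set `{v k₃ = v k₁}` the functions `v k₁ - v(h)`,
`v k₃ - v(k₄)` and the vertex are real-analytic (part B) and each has ISOLATED zeros: `v₁ ≡ v₂` near a
point would put the continuous lift `φ₁` into the null level set `{v = v k₁}`, `v₃ ≡ v₄` would make
`φ₁' = (v₃-v₄)/(v₂-v₄) ≡ 0` — either way `φ₁` is constant on an interval, i.e. `Ω(k₁, c, ·) ≡ 0`,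
excluded by `resonanceFn_const_partner` (part A); the vertex vanishing near a point would vanish, by
the identity theorem, up to the next equal-velocity point `β` of the fibre, contradicting the endpoint
lemma `vertex_seq_ne_zero` (part B). Hence all exceptional sets of a fibre are null
(`volume_zeros_null_of_isolated`), `v₁ = v₄`, `v₂ = v₃`, `v₂ = v₄` are excluded pointwise off the
curve (part B and GA), a null set misses a point (C1), and Tonelli gives (C3).
-/

noncomputable section

open MeasureTheory Set Real Filter Topology
open scoped ENNReal
open Literature.MathematicalPhysics.KineticTheory.PhononBoltzmann
open Summit.AtomisticToContinuum.FouriersLaw.Theorems.FGRGap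

namespace Summit.AtomisticToContinuum.FouriersLaw.Theorems.FGRGap.FoldJetRigidity.Generic

variable {ω₂ : ℝ}

/-! ## Part C: isolated zeros along the fibres, null exceptional sets, assembly -/

section PartC

variable {h : ℝ → ℝ → ℝ}

/-- A lift that is constant on an interval of a fibre contradicts the rigidity of the band
(`resonanceFn_const_partner`). -/
theorem lift_not_const (hω : 0 < ω₂)
    (hres : ∀ k₁ k₃ : ℝ, resonanceFn ω₂ k₁ (h k₁ k₃) k₃ = 0)
    {k₁ c α β : ℝ} {φ₁ : ℝ → ℝ} (hαβ : α < β)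
    (hlh : ∀ k₃ ∈ Ioo α β, ∃ n : ℤ, φ₁ k₃ = h k₁ k₃ + n * (2 * π))
    (hc : ∀ k₃ ∈ Ioo α β, φ₁ k₃ = c) : False := by
  refine resonanceFn_const_partner hω k₁ c hαβ fun s hs => ?_
  obtain ⟨n, hn⟩ := hlh s hs
  rw [← hc s hs, hn, resonanceFn_snd_add_int_mul_two_pi]
  exact hres k₁ s

/-- **`v₁ = v₂` has isolated solutions along a fibre** (off the curve): if `v(h k₁ ·) ≡ v k₁` near
`x`, the lift takes values in the countable level set `{v = v k₁}`, hence is constant on an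
interval — impossible. -/
theorem isolated_v1_eq_v2 (hω : 0 < ω₂)
    (hres : ∀ k₁ k₃ : ℝ, resonanceFn ω₂ k₁ (h k₁ k₃) k₃ = 0)
    (hfl : ∀ k₁ x : ℝ, groupVelocity ω₂ x ≠ groupVelocity ω₂ k₁ → ∃ φ₁ : ℝ → ℝ, ∃ ε > 0,
      (∀ k₃ ∈ Ioo (x - ε) (x + ε), AnalyticAt ℝ φ₁ k₃) ∧
      (∀ k₃ ∈ Ioo (x - ε) (x + ε), ∃ n : ℤ, φ₁ k₃ = h k₁ k₃ + n * (2 * π)) ∧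
      (∀ k₃ ∈ Ioo (x - ε) (x + ε), HasDerivAt φ₁
        ((groupVelocity ω₂ k₃ - groupVelocity ω₂ (k₁ + φ₁ k₃ - k₃)) /
          (groupVelocity ω₂ (φ₁ k₃) - groupVelocity ω₂ (k₁ + φ₁ k₃ - k₃))) k₃))
    (k₁ x : ℝ) (hW : groupVelocity ω₂ x ≠ groupVelocity ω₂ k₁)
    (_hx : groupVelocity ω₂ k₁ - groupVelocity ω₂ (h k₁ x) = 0) :
    ∀ᶠ y in 𝓝[≠] x, groupVelocity ω₂ k₁ - groupVelocity ω₂ (h k₁ y) ≠ 0 := by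
  have han : AnalyticAt ℝ (fun k₃ => groupVelocity ω₂ k₁ - groupVelocity ω₂ (h k₁ k₃)) x :=
    analyticAt_const.sub (analyticAt_groupVelocity_partner hω hfl hW)
  rcases han.eventually_eq_zero_or_eventually_ne_zero with hzero | hne
  swap
  · exact hne
  exfalso
  obtain ⟨φ₁, ε, hε, hφan, hlh, -⟩ := hfl k₁ x hW
  obtain ⟨δ₀, hδ₀, hz⟩ := Metric.eventually_nhds_iff.1 hzero
  set δ := min δ₀ ε with hδ
  have hδpos : 0 < δ := lt_min hδ₀ hε
  have hsub : Ioo (x - δ) (x + δ) ⊆ Ioo (x - ε) (x + ε) := fun y hy =>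
    ⟨by linarith [hy.1, min_le_right δ₀ ε], by linarith [hy.2, min_le_right δ₀ ε]⟩
  have hzero' : ∀ y ∈ Ioo (x - δ) (x + δ), groupVelocity ω₂ (φ₁ y) = groupVelocity ω₂ k₁ := by
    intro y hy
    have hdist : dist y x < δ₀ := by
      rw [Real.dist_eq, abs_lt]
      constructor <;> linarith [hy.1, hy.2, min_le_left δ₀ ε]
    have h0 := hz hdist
    obtain ⟨n, hn⟩ := hlh y (hsub hy)
    rw [hn, groupVelocity_add_int_mul_two_pi]
    linarith
  have hcont : ContinuousOn φ₁ (Ioo (x - δ) (x + δ)) := fun y hy =>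
    (hφan y (hsub hy)).continuousAt.continuousWithinAt
  have hconst : ∀ y ∈ Ioo (x - δ) (x + δ), φ₁ y = φ₁ x := fun y hy =>
    const_of_continuousOn_of_null_range (volume_groupVelocity_fibre hω (groupVelocity ω₂ k₁))
      hcont hzero' hy ⟨by linarith, by linarith⟩
  exact lift_not_const hω hres (by linarith : x - δ < x + δ) (fun y hy => hlh y (hsub hy)) hconst

/-- **`v₃ = v₄` has isolated solutions along a fibre** (off the curve): if `v(k₃) ≡ v(k₄)` near
`x`, the implicit derivative `∂₃φ = (v₃-v₄)/(v₂-v₄)` vanishes, so the lift is constant on an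
interval — impossible. -/
theorem isolated_v3_eq_v4 (hω : 0 < ω₂)
    (hres : ∀ k₁ k₃ : ℝ, resonanceFn ω₂ k₁ (h k₁ k₃) k₃ = 0)
    (hfl : ∀ k₁ x : ℝ, groupVelocity ω₂ x ≠ groupVelocity ω₂ k₁ → ∃ φ₁ : ℝ → ℝ, ∃ ε > 0,
      (∀ k₃ ∈ Ioo (x - ε) (x + ε), AnalyticAt ℝ φ₁ k₃) ∧
      (∀ k₃ ∈ Ioo (x - ε) (x + ε), ∃ n : ℤ, φ₁ k₃ = h k₁ k₃ + n * (2 * π)) ∧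
      (∀ k₃ ∈ Ioo (x - ε) (x + ε), HasDerivAt φ₁
        ((groupVelocity ω₂ k₃ - groupVelocity ω₂ (k₁ + φ₁ k₃ - k₃)) /
          (groupVelocity ω₂ (φ₁ k₃) - groupVelocity ω₂ (k₁ + φ₁ k₃ - k₃))) k₃))
    (k₁ x : ℝ) (hW : groupVelocity ω₂ x ≠ groupVelocity ω₂ k₁)
    (_hx : groupVelocity ω₂ x - groupVelocity ω₂ (k₁ + h k₁ x - x) = 0) :
    ∀ᶠ y in 𝓝[≠] x, groupVelocity ω₂ y - groupVelocity ω₂ (k₁ + h k₁ y - y) ≠ 0 := by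
  have han : AnalyticAt ℝ
      (fun k₃ => groupVelocity ω₂ k₃ - groupVelocity ω₂ (k₁ + h k₁ k₃ - k₃)) x :=
    (analyticAt_groupVelocity hω x).sub (analyticAt_groupVelocity_k4 hω hfl hW)
  rcases han.eventually_eq_zero_or_eventually_ne_zero with hzero | hne
  swap
  · exact hne
  exfalso
  obtain ⟨φ₁, ε, hε, -, hlh, hder⟩ := hfl k₁ x hW
  obtain ⟨δ₀, hδ₀, hz⟩ := Metric.eventually_nhds_iff.1 hzero
  set δ := min δ₀ ε with hδ
  have hδpos : 0 < δ := lt_min hδ₀ hε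
  have hsub : Ioo (x - δ) (x + δ) ⊆ Ioo (x - ε) (x + ε) := fun y hy =>
    ⟨by linarith [hy.1, min_le_right δ₀ ε], by linarith [hy.2, min_le_right δ₀ ε]⟩
  have hder0 : ∀ y ∈ Ioo (x - δ) (x + δ), HasDerivAt φ₁ 0 y := by
    intro y hy
    have hdist : dist y x < δ₀ := by
      rw [Real.dist_eq, abs_lt]
      constructor <;> linarith [hy.1, hy.2, min_le_left δ₀ ε]
    have h0 : groupVelocity ω₂ y - groupVelocity ω₂ (k₁ + h k₁ y - y) = 0 := hz hdist
    obtain ⟨n, hn⟩ := hlh y (hsub hy)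
    have h0' : groupVelocity ω₂ y - groupVelocity ω₂ (k₁ + φ₁ y - y) = 0 := by
      rw [hn, show k₁ + (h k₁ y + n * (2 * π)) - y = (k₁ + h k₁ y - y) + n * (2 * π) by ring,
        groupVelocity_add_int_mul_two_pi]
      exact h0
    have hd := hder y (hsub hy)
    rw [h0', zero_div] at hd
    exact hd
  have hconst : ∀ y ∈ Ioo (x - δ) (x + δ), φ₁ y = φ₁ x := fun y hy =>
    const_of_hasDerivAt_zero hder0 hy ⟨by linarith, by linarith⟩
  exact lift_not_const hω hres (by linarith : x - δ < x + δ) (fun y hy => hlh y (hsub hy)) hconst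

/-- **The vertex has isolated zeros along a fibre** (off the curve; `a > 0`, `b ≥ 0`): if it
vanished near `x`, by the identity theorem it would vanish up to the next equal-velocity point
`β > x`, contradicting the endpoint lemma `vertex_seq_ne_zero`. -/
theorem isolated_vertex (hω : 0 < ω₂) (hcell : ∀ k₁ k₃ : ℝ, h k₁ k₃ ∈ Set.Ioc (-π) π)
    (hres : ∀ k₁ k₃ : ℝ, resonanceFn ω₂ k₁ (h k₁ k₃) k₃ = 0)
    (htwo : ∀ k₁ k₃ : ℝ, (∀ n : ℤ, k₃ - k₁ ≠ n * (2 * π)) →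
      resonantSet ω₂ k₁ k₃ = {toIocMod Real.two_pi_pos (-π) k₃, h k₁ k₃})
    (htriv : ∀ k₁ k₃ : ℝ, (∀ n : ℤ, k₃ - k₁ ≠ n * (2 * π)) →
      (h k₁ k₃ = toIocMod Real.two_pi_pos (-π) k₃ ↔ groupVelocity ω₂ k₃ = groupVelocity ω₂ k₁))
    (hfl : ∀ k₁ x : ℝ, groupVelocity ω₂ x ≠ groupVelocity ω₂ k₁ → ∃ φ₁ : ℝ → ℝ, ∃ ε > 0,
      (∀ k₃ ∈ Ioo (x - ε) (x + ε), AnalyticAt ℝ φ₁ k₃) ∧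
      (∀ k₃ ∈ Ioo (x - ε) (x + ε), ∃ n : ℤ, φ₁ k₃ = h k₁ k₃ + n * (2 * π)) ∧
      (∀ k₃ ∈ Ioo (x - ε) (x + ε), HasDerivAt φ₁
        ((groupVelocity ω₂ k₃ - groupVelocity ω₂ (k₁ + φ₁ k₃ - k₃)) /
          (groupVelocity ω₂ (φ₁ k₃) - groupVelocity ω₂ (k₁ + φ₁ k₃ - k₃))) k₃))
    {a b : ℝ} (ha : 0 < a) (hb : 0 ≤ b) (k₁ x : ℝ)
    (hW : groupVelocity ω₂ x ≠ groupVelocity ω₂ k₁) (_hx : vertex a b k₁ (h k₁ x) x = 0) :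
    ∀ᶠ y in 𝓝[≠] x, vertex a b k₁ (h k₁ y) y ≠ 0 := by
  rcases (analyticAt_vertex_partner hfl a b hW).eventually_eq_zero_or_eventually_ne_zero with
    hzero | hne
  swap
  · exact hne
  exfalso
  obtain ⟨β, hxβ, hβv, hIoo⟩ := exists_next_equalVelocity hω k₁ x
  have hUan : AnalyticOnNhd ℝ (fun k₃ => vertex a b k₁ (h k₁ k₃) k₃) (Ico x β) := by
    intro y hy
    rcases eq_or_lt_of_le hy.1 with hxy | hxy
    · rw [← hxy]
      exact analyticAt_vertex_partner hfl a b hW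
    · exact analyticAt_vertex_partner hfl a b (hIoo y ⟨hxy, hy.2⟩)
  have hEq : EqOn (fun k₃ => vertex a b k₁ (h k₁ k₃) k₃) 0 (Ico x β) :=
    hUan.eqOn_zero_of_preconnected_of_eventuallyEq_zero isPreconnected_Ico ⟨le_rfl, hxβ⟩ hzero
  obtain ⟨u, -, huI, hu⟩ := exists_seq_strictMono_tendsto' hxβ
  exact vertex_seq_ne_zero hcell hres htwo htriv ha hb hβv hu fun j =>
    hEq ⟨(huI j).1.le, (huI j).2⟩

/-- Null fibre: `{k₃ | v k₁ = v(h k₁ k₃)}`. -/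
theorem volume_fibre_v1_eq_v2 (hω : 0 < ω₂)
    (hres : ∀ k₁ k₃ : ℝ, resonanceFn ω₂ k₁ (h k₁ k₃) k₃ = 0)
    (hfl : ∀ k₁ x : ℝ, groupVelocity ω₂ x ≠ groupVelocity ω₂ k₁ → ∃ φ₁ : ℝ → ℝ, ∃ ε > 0,
      (∀ k₃ ∈ Ioo (x - ε) (x + ε), AnalyticAt ℝ φ₁ k₃) ∧
      (∀ k₃ ∈ Ioo (x - ε) (x + ε), ∃ n : ℤ, φ₁ k₃ = h k₁ k₃ + n * (2 * π)) ∧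
      (∀ k₃ ∈ Ioo (x - ε) (x + ε), HasDerivAt φ₁
        ((groupVelocity ω₂ k₃ - groupVelocity ω₂ (k₁ + φ₁ k₃ - k₃)) /
          (groupVelocity ω₂ (φ₁ k₃) - groupVelocity ω₂ (k₁ + φ₁ k₃ - k₃))) k₃))
    (k₁ : ℝ) :
    volume {k₃ | groupVelocity ω₂ k₁ - groupVelocity ω₂ (h k₁ k₃) = 0} = 0 :=
  volume_zeros_null_of_isolated (volume_groupVelocity_fibre hω (groupVelocity ω₂ k₁))
    fun x hxZ hx0 => isolated_v1_eq_v2 hω hres hfl k₁ x hxZ hx0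

/-- Null fibre: `{k₃ | v k₃ = v(k₄)}`. -/
theorem volume_fibre_v3_eq_v4 (hω : 0 < ω₂)
    (hres : ∀ k₁ k₃ : ℝ, resonanceFn ω₂ k₁ (h k₁ k₃) k₃ = 0)
    (hfl : ∀ k₁ x : ℝ, groupVelocity ω₂ x ≠ groupVelocity ω₂ k₁ → ∃ φ₁ : ℝ → ℝ, ∃ ε > 0,
      (∀ k₃ ∈ Ioo (x - ε) (x + ε), AnalyticAt ℝ φ₁ k₃) ∧
      (∀ k₃ ∈ Ioo (x - ε) (x + ε), ∃ n : ℤ, φ₁ k₃ = h k₁ k₃ + n * (2 * π)) ∧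
      (∀ k₃ ∈ Ioo (x - ε) (x + ε), HasDerivAt φ₁
        ((groupVelocity ω₂ k₃ - groupVelocity ω₂ (k₁ + φ₁ k₃ - k₃)) /
          (groupVelocity ω₂ (φ₁ k₃) - groupVelocity ω₂ (k₁ + φ₁ k₃ - k₃))) k₃))
    (k₁ : ℝ) :
    volume {k₃ | groupVelocity ω₂ k₃ - groupVelocity ω₂ (k₁ + h k₁ k₃ - k₃) = 0} = 0 :=
  volume_zeros_null_of_isolated (volume_groupVelocity_fibre hω (groupVelocity ω₂ k₁))
    fun x hxZ hx0 => isolated_v3_eq_v4 hω hres hfl k₁ x hxZ hx0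

/-- Null fibre of the vertex zero set (`a > 0`, `b ≥ 0`). -/
theorem volume_fibre_vertex (hω : 0 < ω₂) (hcell : ∀ k₁ k₃ : ℝ, h k₁ k₃ ∈ Set.Ioc (-π) π)
    (hres : ∀ k₁ k₃ : ℝ, resonanceFn ω₂ k₁ (h k₁ k₃) k₃ = 0)
    (htwo : ∀ k₁ k₃ : ℝ, (∀ n : ℤ, k₃ - k₁ ≠ n * (2 * π)) →
      resonantSet ω₂ k₁ k₃ = {toIocMod Real.two_pi_pos (-π) k₃, h k₁ k₃})
    (htriv : ∀ k₁ k₃ : ℝ, (∀ n : ℤ, k₃ - k₁ ≠ n * (2 * π)) →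
      (h k₁ k₃ = toIocMod Real.two_pi_pos (-π) k₃ ↔ groupVelocity ω₂ k₃ = groupVelocity ω₂ k₁))
    (hfl : ∀ k₁ x : ℝ, groupVelocity ω₂ x ≠ groupVelocity ω₂ k₁ → ∃ φ₁ : ℝ → ℝ, ∃ ε > 0,
      (∀ k₃ ∈ Ioo (x - ε) (x + ε), AnalyticAt ℝ φ₁ k₃) ∧
      (∀ k₃ ∈ Ioo (x - ε) (x + ε), ∃ n : ℤ, φ₁ k₃ = h k₁ k₃ + n * (2 * π)) ∧
      (∀ k₃ ∈ Ioo (x - ε) (x + ε), HasDerivAt φ₁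
        ((groupVelocity ω₂ k₃ - groupVelocity ω₂ (k₁ + φ₁ k₃ - k₃)) /
          (groupVelocity ω₂ (φ₁ k₃) - groupVelocity ω₂ (k₁ + φ₁ k₃ - k₃))) k₃))
    {a b : ℝ} (ha : 0 < a) (hb : 0 ≤ b) (k₁ : ℝ) :
    volume {k₃ | vertex a b k₁ (h k₁ k₃) k₃ = 0} = 0 :=
  volume_zeros_null_of_isolated (volume_groupVelocity_fibre hω (groupVelocity ω₂ k₁))
    fun x hxZ hx0 => isolated_vertex hω hcell hres htwo htriv hfl ha hb k₁ x hxZ hx0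

/-- **(C3)** The vertex zero set `{(k₁,k₃) | vertex a b k₁ (h k₁ k₃) k₃ = 0}` is null in `ℝ²`
(`a > 0`, `b ≥ 0`; Tonelli over the null fibres, measurability from that of `h`). -/
theorem volume_vertex_zero (hω : 0 < ω₂) (hcell : ∀ k₁ k₃ : ℝ, h k₁ k₃ ∈ Set.Ioc (-π) π)
    (hres : ∀ k₁ k₃ : ℝ, resonanceFn ω₂ k₁ (h k₁ k₃) k₃ = 0)
    (htwo : ∀ k₁ k₃ : ℝ, (∀ n : ℤ, k₃ - k₁ ≠ n * (2 * π)) →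
      resonantSet ω₂ k₁ k₃ = {toIocMod Real.two_pi_pos (-π) k₃, h k₁ k₃})
    (htriv : ∀ k₁ k₃ : ℝ, (∀ n : ℤ, k₃ - k₁ ≠ n * (2 * π)) →
      (h k₁ k₃ = toIocMod Real.two_pi_pos (-π) k₃ ↔ groupVelocity ω₂ k₃ = groupVelocity ω₂ k₁))
    (hmeas : Measurable (Function.uncurry h))
    (hfl : ∀ k₁ x : ℝ, groupVelocity ω₂ x ≠ groupVelocity ω₂ k₁ → ∃ φ₁ : ℝ → ℝ, ∃ ε > 0,
      (∀ k₃ ∈ Ioo (x - ε) (x + ε), AnalyticAt ℝ φ₁ k₃) ∧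
      (∀ k₃ ∈ Ioo (x - ε) (x + ε), ∃ n : ℤ, φ₁ k₃ = h k₁ k₃ + n * (2 * π)) ∧
      (∀ k₃ ∈ Ioo (x - ε) (x + ε), HasDerivAt φ₁
        ((groupVelocity ω₂ k₃ - groupVelocity ω₂ (k₁ + φ₁ k₃ - k₃)) /
          (groupVelocity ω₂ (φ₁ k₃) - groupVelocity ω₂ (k₁ + φ₁ k₃ - k₃))) k₃))
    {a b : ℝ} (ha : 0 < a) (hb : 0 ≤ b) :
    volume {p : ℝ × ℝ | vertex a b p.1 (h p.1 p.2) p.2 = 0} = 0 := by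
  apply volume_prod_null_of_fibre
  · have hm : Measurable fun p : ℝ × ℝ => h p.1 p.2 := hmeas
    have hF : Measurable fun p : ℝ × ℝ => vertex a b p.1 (h p.1 p.2) p.2 := by
      unfold vertex
      fun_prop
    exact measurableSet_eq_fun hF measurable_const
  · intro k₁
    exact volume_fibre_vertex hω hcell hres htwo htriv hfl ha hb k₁

/-- **GB assembled**: for a partner map with the GA properties, (C1) every fibre carries a
general-position resonance with non-vanishing unit vertex, (C2) the equal-velocity set is null,
(C3) the vertex zero sets are null. (C1): the four exceptional sets `{v₃ = v₁}`, `{v₁ = v₂}`,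
`{v₃ = v₄}`, `{vertex = 0}` of the fibre are null, `{v₂ = v₄}`, `{v₁ = v₄}`, `{v₂ = v₃}` lie in the
first, and a null set misses a point. -/
theorem fibreGenericity (hω : 0 < ω₂) (h : ℝ → ℝ → ℝ)
    (hB : (∀ k₁ k₃ : ℝ, h k₁ k₃ ∈ Set.Ioc (-π) π) ∧
        (∀ k₁ k₃ : ℝ, resonanceFn ω₂ k₁ (h k₁ k₃) k₃ = 0) ∧
        (∀ k₁ k₃ : ℝ, h (k₁ + 2 * π) k₃ = h k₁ k₃ ∧ h k₁ (k₃ + 2 * π) = h k₁ k₃) ∧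
        (∀ k : ℝ, k ∈ Set.Ioc (-π) π → h k k = k) ∧
        (∀ k₁ k₃ : ℝ, (∀ n : ℤ, k₃ - k₁ ≠ n * (2 * π)) →
          resonantSet ω₂ k₁ k₃ = {toIocMod Real.two_pi_pos (-π) k₃, h k₁ k₃}) ∧
        (∀ k₁ k₃ : ℝ, (∀ n : ℤ, k₃ - k₁ ≠ n * (2 * π)) →
          (h k₁ k₃ = toIocMod Real.two_pi_pos (-π) k₃ ↔
            groupVelocity ω₂ k₃ = groupVelocity ω₂ k₁)) ∧
        (∀ k₁ k₃ : ℝ, groupVelocity ω₂ k₃ ≠ groupVelocity ω₂ k₁ →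
          groupVelocity ω₂ (h k₁ k₃) ≠ groupVelocity ω₂ (k₁ + h k₁ k₃ - k₃)) ∧
        Measurable (Function.uncurry h) ∧
        (∀ k₁ k₃ : ℝ, groupVelocity ω₂ k₃ ≠ groupVelocity ω₂ k₁ →
          ∃ (φ : ℝ × ℝ → ℝ) (U : Set (ℝ × ℝ)), U ∈ 𝓝 (k₁, k₃) ∧ AnalyticOnNhd ℝ φ U ∧
            φ (k₁, k₃) = h k₁ k₃ ∧ (∀ p ∈ U, ∃ n : ℤ, φ p = h p.1 p.2 + n * (2 * π)) ∧
            (∀ p ∈ U, groupVelocity ω₂ p.2 ≠ groupVelocity ω₂ p.1) ∧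
            (∀ p ∈ U, HasStrictFDerivAt φ
              (((groupVelocity ω₂ (p.1 + φ p - p.2) - groupVelocity ω₂ p.1) /
                (groupVelocity ω₂ (φ p) - groupVelocity ω₂ (p.1 + φ p - p.2))) •
                  ContinuousLinearMap.fst ℝ ℝ ℝ +
              ((groupVelocity ω₂ p.2 - groupVelocity ω₂ (p.1 + φ p - p.2)) /
                (groupVelocity ω₂ (φ p) - groupVelocity ω₂ (p.1 + φ p - p.2))) •
                  ContinuousLinearMap.snd ℝ ℝ ℝ) p))) :
    (∀ k₁ r : ℝ, 0 ≤ r → ∃ k₃ : ℝ,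
        groupVelocity ω₂ k₁ ≠ groupVelocity ω₂ (h k₁ k₃) ∧
        groupVelocity ω₂ k₁ ≠ groupVelocity ω₂ k₃ ∧
        groupVelocity ω₂ k₁ ≠ groupVelocity ω₂ (k₁ + h k₁ k₃ - k₃) ∧
        groupVelocity ω₂ (h k₁ k₃) ≠ groupVelocity ω₂ k₃ ∧
        groupVelocity ω₂ (h k₁ k₃) ≠ groupVelocity ω₂ (k₁ + h k₁ k₃ - k₃) ∧
        groupVelocity ω₂ k₃ ≠ groupVelocity ω₂ (k₁ + h k₁ k₃ - k₃) ∧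
        vertex 1 r k₁ (h k₁ k₃) k₃ ≠ 0) ∧
      MeasureTheory.volume
        {p : ℝ × ℝ | groupVelocity ω₂ p.2 = groupVelocity ω₂ p.1} = 0 ∧
      (∀ a b : ℝ, 0 < a → 0 ≤ b →
        MeasureTheory.volume {p : ℝ × ℝ | vertex a b p.1 (h p.1 p.2) p.2 = 0} = 0) := by
  obtain ⟨hcell, hres, -, -, htwo, htriv, hjac, hmeas, hlift⟩ := hB
  have hfl := exists_fibre_lift hlift
  refine ⟨fun k₁ r hr => ?_, volume_equalVelocity hω,
    fun a b ha hb => volume_vertex_zero hω hcell hres htwo htriv hmeas hfl ha hb⟩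
  have hN := measure_union_null (measure_union_null (measure_union_null
    (volume_groupVelocity_fibre hω (groupVelocity ω₂ k₁))
    (volume_fibre_v1_eq_v2 hω hres hfl k₁))
    (volume_fibre_v3_eq_v4 hω hres hfl k₁))
    (volume_fibre_vertex hω hcell hres htwo htriv hfl one_pos hr k₁)
  obtain ⟨k₃, hk₃⟩ := exists_not_mem_of_volume_zero hN
  simp only [mem_union, mem_setOf_eq, not_or] at hk₃
  obtain ⟨⟨⟨h13, h12⟩, h34⟩, hu⟩ := hk₃
  exact ⟨k₃, sub_ne_zero.1 h12, Ne.symm h13,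
    Ne.symm (groupVelocity_k4_ne_k1 hcell hres htwo htriv h13),
    groupVelocity_partner_ne_k3 hcell hres htwo htriv h13, hjac k₁ k₃ h13, sub_ne_zero.1 h34, hu⟩

end PartC

end Summit.AtomisticToContinuum.FouriersLaw.Theorems.FGRGap.FoldJetRigidity.Generic

namespace Summit.AtomisticToContinuum.FouriersLaw.Theorems.FGRGap.FoldJetRigidity

/-- **GB — FIBRE GENERICITY (general-position resonances on every fibre; null exceptional sets).**
For `ω₂ > 0` and any partner map `h` with the GA properties: (1) for every `k₁` and every `r ≥ 0`
there is `k₃` such that the resonance `(k₁, h; k₃, k₄)` is in general position (all six group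
velocities pairwise distinct) and has unit vertex `vertex 1 r ≠ 0`; (2) the equal-velocity set
`{v(k₃) = v(k₁)}` is Lebesgue-null in `ℝ²`; (3) for `a > 0`, `b ≥ 0` the vertex zero set
`{vertex a b k₁ h k₃ = 0}` is Lebesgue-null. Proof: `Generic.fibreGenericity`. [folklore] -/
theorem stub_fibreGenericity :
    ∀ ω₂ : ℝ, 0 < ω₂ → ∀ h : ℝ → ℝ → ℝ,
      ((∀ k₁ k₃ : ℝ, h k₁ k₃ ∈ Set.Ioc (-π) π) ∧
        (∀ k₁ k₃ : ℝ, resonanceFn ω₂ k₁ (h k₁ k₃) k₃ = 0) ∧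
        (∀ k₁ k₃ : ℝ, h (k₁ + 2 * π) k₃ = h k₁ k₃ ∧ h k₁ (k₃ + 2 * π) = h k₁ k₃) ∧
        (∀ k : ℝ, k ∈ Set.Ioc (-π) π → h k k = k) ∧
        (∀ k₁ k₃ : ℝ, (∀ n : ℤ, k₃ - k₁ ≠ n * (2 * π)) →
          resonantSet ω₂ k₁ k₃ = {toIocMod Real.two_pi_pos (-π) k₃, h k₁ k₃}) ∧
        (∀ k₁ k₃ : ℝ, (∀ n : ℤ, k₃ - k₁ ≠ n * (2 * π)) →
          (h k₁ k₃ = toIocMod Real.two_pi_pos (-π) k₃ ↔ groupVelocity ω₂ k₃ = groupVelocity ω₂ k₁)) ∧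
        (∀ k₁ k₃ : ℝ, groupVelocity ω₂ k₃ ≠ groupVelocity ω₂ k₁ →
          groupVelocity ω₂ (h k₁ k₃) ≠ groupVelocity ω₂ (k₁ + h k₁ k₃ - k₃)) ∧
        Measurable (Function.uncurry h) ∧
        (∀ k₁ k₃ : ℝ, groupVelocity ω₂ k₃ ≠ groupVelocity ω₂ k₁ →
          ∃ (φ : ℝ × ℝ → ℝ) (U : Set (ℝ × ℝ)), U ∈ 𝓝 (k₁, k₃) ∧ AnalyticOnNhd ℝ φ U ∧
            φ (k₁, k₃) = h k₁ k₃ ∧ (∀ p ∈ U, ∃ n : ℤ, φ p = h p.1 p.2 + n * (2 * π)) ∧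
            (∀ p ∈ U, groupVelocity ω₂ p.2 ≠ groupVelocity ω₂ p.1) ∧
            (∀ p ∈ U, HasStrictFDerivAt φ (((groupVelocity ω₂ (p.1 + φ p - p.2) - groupVelocity ω₂ p.1) /
              (groupVelocity ω₂ (φ p) - groupVelocity ω₂ (p.1 + φ p - p.2))) • ContinuousLinearMap.fst ℝ ℝ ℝ +
            ((groupVelocity ω₂ p.2 - groupVelocity ω₂ (p.1 + φ p - p.2)) /
              (groupVelocity ω₂ (φ p) - groupVelocity ω₂ (p.1 + φ p - p.2))) • ContinuousLinearMap.snd ℝ ℝ ℝ) p))) →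
      ((∀ k₁ r : ℝ, 0 ≤ r → ∃ k₃ : ℝ,
          groupVelocity ω₂ k₁ ≠ groupVelocity ω₂ (h k₁ k₃) ∧ groupVelocity ω₂ k₁ ≠ groupVelocity ω₂ k₃ ∧
          groupVelocity ω₂ k₁ ≠ groupVelocity ω₂ (k₁ + h k₁ k₃ - k₃) ∧ groupVelocity ω₂ (h k₁ k₃) ≠ groupVelocity ω₂ k₃ ∧
          groupVelocity ω₂ (h k₁ k₃) ≠ groupVelocity ω₂ (k₁ + h k₁ k₃ - k₃) ∧ groupVelocity ω₂ k₃ ≠ groupVelocity ω₂ (k₁ + h k₁ k₃ - k₃) ∧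
          vertex 1 r k₁ (h k₁ k₃) k₃ ≠ 0) ∧
        MeasureTheory.volume {p : ℝ × ℝ | groupVelocity ω₂ p.2 = groupVelocity ω₂ p.1} = 0 ∧
        (∀ a b : ℝ, 0 < a → 0 ≤ b →
          MeasureTheory.volume {p : ℝ × ℝ | vertex a b p.1 (h p.1 p.2) p.2 = 0} = 0)) := by
  intro ω₂ hω h hB
  exact Generic.fibreGenericity hω h hB

end Summit.AtomisticToContinuum.FouriersLaw.Theorems.FGRGap.FoldJetRigidity

end
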